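import Literature.MathematicalPhysics.QuantumFieldTheory.Balaban1983to89.Beta.OneStepResolventKernel
import Literature.MathematicalPhysics.QuantumFieldTheory.Balaban1983to89.Beta.ScalewiseVectorSeam

/-!
# The one-step kernel FAMILY of the genuine step-`j` systems: block-contour decimation of the composite resolvent, chain-rule
# vertices through an arbitrary packed resolvent, the families `Tbal` / `𝒯bal` over jet data, and the two EXIT-B predicates
# `D1Tel` / `D1Rep` (read-out = `ScalewiseVectorSeam.readout122` by name)
# VERSIONS: v1 p186618 b719fce2d3d2 (§1–§7); v1.1 p187555 04fd8fc25aa7 (APPEND-ONLY): §8 — (a) the `hdec` slot `hdec_hessKer_of_decays`, `hdec_TOf`,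
# `hdec_TstepOf`, `hdec_TbalOf`, `hdec_TshotOf` (uniform (5.10)-type decay of the typed kernels for EVERY jet datum, via the lead's
# `ExpKernelCalculus.hdec_hessKer` v1.3); (b) the DIFFERENCE-VARIABLE bridge `flipK T μ ν z := T μ ν (−z)` (`hessKer`'s variable is
# second-minus-first, [B12] p.293 (5.8)'s is first-minus-second) with `decay510_flipK`, `hasSum_flipK_iff`, `hasSum_firstMoment_of_flipK`,
# `secondMoment_flipK`, `wardTransversal_flipK_iff`, `axisReflectionCovariant_flipK_iff`; (c) the endpoints `endpointExistence_of_D1_T0T1`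
# (convention-free: (T0)/(T1) asked directly) and `endpointExistence_of_D1_printed` (`hdec` DISCHARGED; the printed (5.7)/(5.9) asked of
# `flipK (TbalOf Lc Js j)`; remaining binders `hW`, `hR`, `hβ`, `D1Tel`, `D1Rep` + the standing hypotheses); §9 (RULING (R23) of the β sub-cell lead) —
# the EXIT-B STATEMENT `D1Drift Lc Js N μ ν` (one-loop drift of `j ↦ secondMoment (TbalOf Lc Js j) μ ν` with slope
# `B12Normalization.stepBal N Lc` up to a bounded cumulative defect — a predicate over the jet parameters, never a fact) and the
# four-binder END `endpointExistence_of_D1Drift` (an4's `DriftRemainder.endpointExistence_of_drift_remainderConst_cont` at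
# `β⁰ := secondMoment ∘ TbalOf`); v1.2 (APPEND-ONLY, this file): §10 — `d1Drift_of_D1Tel_D1Rep` (the scale-wise data in the flipped-printed
# form + `D1Tel` + `D1Rep` ⇒ `D1Drift`, by the lead's `ScalewiseVectorSeam.oneLoopDrift_of_scalewise_printed_flip` / `splitOf`, v1.6) and
# `endpointExistence_of_D1_printed_cont` (the END with (D5) = (C) only, RULING (R22)); header: the print anchor of the decimation weight
# (XREAD advisory A1 of the cell's literature seat, [Balaban1984PropagatorsI] p. 19 (1.11)).

HONEST FRAMING (page 1).  Discharging `FlowStep.BetaPertH` would make Bałaban's ultraviolet stability UNCONDITIONAL — a real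
constructive-QFT result; it is NOT the continuum limit and NOT the Clay problem.  This file discharges nothing of `BetaPertH`: it is
DEFINITIONS + ELEMENTARY KERNEL CALCULUS (finite sums, the triangle inequality, the lemmas of `Beta/ExpKernelCalculus` and
`Beta/OneStepResolventKernel`).  Its value is that the hypotheses `(T 𝒯 : ℕ → EKer 4) (hTA : ∀ j c e, AbsMoment₂ (T j c e))`,
`(F) (hFadd)`, `(htel : HessianTelescoping Lc T 𝒯)` and `(hrep : OneShotFullSum Lc F 𝒯 …)` of the endpoint theorems
`HidentScalewise.endpointExistence_of_scalewise_remainderConst` / `ScalewiseVectorSeam.endpointExistence_of_scalewise_vectorSeam(_of_symmetries)`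
now have TYPED CANDIDATE INHABITANTS over explicit jet-data parameters: `TbalOf Lc Js`, `TshotOf Lc Jc` with `hTA` PROVED (the read-out
`F` is the lead's `ScalewiseVectorSeam.readout122 μ ν`, v1.2, BY NAME), and the two remaining obligations stated as the closed predicates
`D1Tel Lc Js Jc` and `D1Rep Lc Jc N μ ν a SL k` — predicates over the parameters, NEVER facts — with the endpoint theorem over jet data
`endpointExistence_of_D1` (§7).  Nothing here asserts that any jet datum IS Bałaban's; the jets (the `B`-derivatives at `B = 0` of
the effective quadratic forms and of the averaging) are sockets (`OneStepResolventKernel.JetData`).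

CONTENT.
* §1 `dec M K` — BLOCK-CONTOUR DECIMATION of a matrix kernel on the packed fibre `Fib d = (field) ⊕ (multiplier)` by a factor `M`:
  field legs are averaged with weight `M^{−(d+2)}` over the straight contours of length `M` of the `M`-blocks (the `U = 1`
  linearisation of the averaging in the coarse-unit convention of B9 (3.14)), multiplier legs are read at the coarse points `M•x′`;
  `decays_dec` (decimation preserves exponential decay: same rate, constant `· e^{4δ(d+1)M}`), `shiftK_dec` (a coarse shift by `v`
  is a fine shift by `M•v`), `dec_inr_left`.
* §2 `KInvStep Lc j := dec (Lc^j) (KInv (Lc^(j+1)))` — the DECIMATED COMPOSITE RESOLVENT: the packed resolvent of the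
  `(j+1)`-step composite system at `U = 1` (blocking `Lc^(j+1)`, `Beta/OneStepResolventKernel`) with its field legs averaged to
  the step-`j` lattice; `decays_KInvStep`, `shiftK_KInvStep` (block covariance under the `Lc`-translations of the step-`j`
  lattice), `proj_pow_smul_eq_zero_iff`, `KInvStep_inr_off` (multiplier legs sit at the `Lc`-coarse points of the step-`j` lattice).
  READING, recorded as the located content of the telescoping predicate and NOT asserted: at `U = 1` the image of the
  `(j+1)`-step composite constrained Gaussian under `A ↦ Q_{Lc^j} A` is the step-`j` fluctuation integral, so `KInvStep Lc j`
  packs the covariance, minimiser and multiplier response of the GENUINE step-`j` system, whose quadratic form is the `j`-step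
  effective operator (B12 (1.20): the vacuum polarization tensor «of the theory defined by the j-th fluctuation field integral»).
* §3 `colH K N μ y`, `vertexOfK K N S μ y := Σ_{κ′} wsum (colH K N μ y κ′) (S κ′)` — the CHAIN-RULE VERTEX through the `ℋ`-column of
  an ARBITRARY packed kernel `K` (for `K = KInv N` it is `OneStepResolventKernel.vertexOf`, `vertexOfK_KInv`);
  `vertexFamily_vertexOfK(')` (a vertex family for any decaying `K` and any local stencil family), `colH_translate`,
  `vertexOfK_translate` (covariance).
* §4 `absMoment₂_hessKer_of_decays` — `AbsMoment₂ (hessKer K V W μ ν)` for ANY decaying `K` and any vertex pair (rates matched).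
* §5 `TstepOf Lc j J := hessKer (KInvStep Lc j) (vertexOfK (KInvStep Lc j) Lc J.S) J.W` — the typed step-`j` kernel of a jet datum;
  `absMoment₂_TstepOf`, `hTA_TstepOf`.
* §6 the families `TbalOf Lc Js j := TstepOf Lc j (Js j)` and `TshotOf Lc Jc m := TOf (N := Lc^m) (Jc m)` (`hTA_TbalOf`,
  `absMoment₂_TshotOf`) and the EXIT-B predicates `D1Tel Lc Js Jc := HessianTelescoping Lc (TbalOf Lc Js) (TshotOf Lc Jc)` and
  `D1Rep Lc Jc N μ ν a SL k := ∃ U, ∀ m ≥ 1, |secondMoment (TshotOf Lc Jc m) μ ν − oneShotSide SL μ ν N a k (Lc^m)| ≤ U` (the printed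
  read-out form of `ScalewiseVectorSeam` §5; `d1Rep_iff_oneShotFullSum`).
* §7 `endpointExistence_of_D1` = `ScalewiseVectorSeam.endpointExistence_of_scalewise_vectorSeam_readout122_of_symmetries` at
  `T := TbalOf Lc Js`, `𝒯 := TshotOf Lc Jc` with `hTA` discharged: `D1Tel`, `D1Rep`, the symmetries `hdiv`/`hinv` of `TbalOf`, the
  identification `hβ : β⁰_j = secondMoment (TbalOf Lc Js j) μ ν` and the cell's standing hypotheses ⇒ `EndpointExistence Cn`.
* §8 (v1.1) (a) the `hdec` slot: `hdec_hessKer_of_decays`, `hdec_TOf`, `hdec_TstepOf`, `hdec_TbalOf`, `hdec_TshotOf` — a UNIFORM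
  exponential decay of every entry of the typed kernels, for every jet datum (per step; constants per `Lc`, `j`); (b) `flipK` — the kernel
  read in the PRINTED difference variable: `hessKer μ ν z` has `z` = second-bond base − first-bond base (`ExpKernelCalculus.hess_eq_hessKer`),
  [Balaban1987RG1] p. 293 (5.8) «Π_{μν}(x, y) = Π_{μν}(x − y)» (first index on «⟨x, x+e_μ⟩», (5.4)/(5.7) ibid.) the opposite; the printed
  (5.7)/(5.9), typed verbatim as `PolarizationSign.AxisReflectionCovariant`/`WardTransversal`, are thus properties of `flipK T` for a
  `hessKer`-convention `T`, and `wardTransversal_flipK_iff`/`axisReflectionCovariant_flipK_iff` spell out the equivalent (mirrored) laws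
  on `T`; the consumed conclusions are flip-insensitive (`hasSum_flipK_iff`, `hasSum_firstMoment_of_flipK`, `secondMoment_flipK`,
  `decay510_flipK`); (c) `endpointExistence_of_D1_T0T1` (the base endpoint at `T := TbalOf`, `𝒯 := TshotOf` with (T0)/(T1) asked directly,
  `hTA` discharged) and `endpointExistence_of_D1_printed` (`hdec` DISCHARGED; `hW`/`hR` := the printed Ward identity / reflection
  covariance of `flipK (TbalOf Lc Js j)`; `hβ`, `D1Tel`, `D1Rep` + the standing hypotheses ⇒ `EndpointExistence Cn`).
* §9 (v1.1; RULING (R23) of the β sub-cell lead, text adapted from the lead's suggested snippet) `D1Drift Lc Js N μ ν :=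
  ∃ A, OneLoopDrift (B12Normalization.stepBal N Lc) A (j ↦ secondMoment (TbalOf Lc Js j) μ ν)` — EXIT-B's STATEMENT SIDE: the
  (1.22)-type coefficients of the typed step systems drift with the asymptotic-freedom slope `stepBal N Lc = (11N²/(12π²))·log Lc`
  up to a bounded cumulative defect (`Beta.Drift.OneLoopDrift`); a predicate over the jet parameters (for Bałaban's stencils: the
  located unprinted one-loop content of B12 Theorem 2 at END grade), never a fact.  `endpointExistence_of_D1Drift`: `D1Drift` + the
  identification `hβ : β⁰_j = secondMoment (TbalOf Lc Js j) μ ν` + the printed remainder constant (D4) `RemainderConst Sβ γ₀ rr` with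
  `rr ≤ stepBal N Lc` + continuity (C) ⇒ `EndpointExistence Cn` — FOUR binders beyond the standing ones; no legs, tables, `K^∞`,
  composite kernels or symmetry binders (an4's `DriftRemainder.endpointExistence_of_drift_remainderConst_cont`).
* §10 (v1.2) `d1Drift_of_D1Tel_D1Rep`: the scale-wise data in the flipped-printed form of §8 (`hdec` discharged by `hdec_TbalOf`; `hW`/`hR`
  asked of `flipK (TbalOf Lc Js j)`, RULING (R21)), `D1Tel` and `D1Rep` give `D1Drift` (the lead's
  `ScalewiseVectorSeam.oneLoopDrift_of_scalewise_printed_flip` at the split `ScalewiseVectorSeam.splitOf (j ↦ secondMoment (TbalOf Lc Js j) μ ν)`,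
  v1.6); `endpointExistence_of_D1_printed_cont`: §8's `endpointExistence_of_D1_printed` with the binders `hβ′ : 0 ≤ β′` and
  `hup : BetaUpperH β′ γ₀ β` DROPPED (RULING (R22), (D5) = (C) only), assembled as `d1Drift_of_D1Tel_D1Rep` ⟹ `endpointExistence_of_D1Drift`.

WHAT IS *NOT* HERE (located, open): the stencil families themselves (the `B`-jets of `Δ(U)`, `J(U)` and of the averaging `Q(U)`,
B9 (3.10)–(3.12), (3.14)–(3.19)); the second-order background response; the identification of `dec`-marginals with the step-`j`
system (part of proving `D1Tel`); the symmetries `(T0)/(T1)` or `hdiv/hinv` of `TbalOf`; and the whole analytic content `D1Rep`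
(B12 (1.7), Sects. 2–5) — equivalently (given the rest) `D1Drift` for Bałaban's jets, whose PROOF is EXIT-A of the cell (the wall).  Print computes `β` WITHOUT Feynman gauge, ghosts or a heat-kernel regulator; so does this file (axial slice of
the cell's typed system; no Faddeev–Popov factor enters at `U = 1`).

ORIENTATION (print, read by this seat on the page renders; locators verified 2026-08-19): T. Bałaban, *Propagators for lattice
gauge theories in a background field*, Commun. Math. Phys. 99 (1985) 389–434 [B9] — p. 393 (3.14) «(1/(L^jη)) Q_j(U,ηA) =
Q_j(U)A + (1/(L^jη)) C_j(U, L^jηA)», (3.15) «Q_j(U) = Q(Ū^{j−1})·…·Q(Ū)Q(U)», (3.16), (3.19); p. 395 (3.26)–(3.27) (the operators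
`Δ_a`, `G`).  PRINT ANCHOR OF THE DECIMATION WEIGHT (v1.2, XREAD advisory A1; render of p. 19 re-read as image 2026-08-19): T. Bałaban,
*Propagators and renormalization transformations for lattice gauge theories. I*, Commun. Math. Phys. 95 (1984) 17–40
[Balaban1984PropagatorsI] — p. 19 (1.11) «(QA)_c = Σ_{x∈B(c₋)} L^{−(d+1)} A([x, x(c)])» (the axial form of the averaging (1.8) ibid., whose
`Γ` legs vanish in the axial gauge (1.10)), «x(c) = x + Le_μ»: weight `L^{−(d+1)}` per bond on print's `d`-dimensional lattice; this file's
lattice is `Fin (d+1) → ℤ`, i.e. PRINT's `d` = FILE's `d+1`, whence `legW (inl) = M^{−(d+2)}` = block mean ∘ contour mean, total weight 1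
(`sum_legW`); `KInvStep`'s `dec (Lc^j)` is the `U = 1` composite `Q_j(1)` by the semigroup identity of straight-contour block means (scalar
analogue of (3.19) above).  T. Bałaban, *Renormalization group approach to lattice gauge field theories. I*, Commun. Math. Phys. 109 (1987)
249–301 [B12] — p. 264 (1.20)–(1.22) (`Π_{j+1}` as the `B`-Hessian of `E^{(j+1)}` at `0`, «the vacuum polarization tensor of the
theory defined by the j-th fluctuation field integral», and `β_{j+1}(g_j) = Σ_x Π_{j+1,μν}(g_j,x) x_μ x_ν for μ, ν arbitrary,
μ ≠ ν`); p. 293 (v1.1, render re-read as image 2026-08-19) (5.7) «Π_{μν}(εx − ((1−ε_μ)/2)e_μ, εy − ((1−ε_ν)/2)e_ν) = ε_μ ε_ν Π_{μν}(x, y)»,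
(5.8) «Π_{μν}(x, y) = Π_{μν}(x − y), Π_{μν}(x) = Π_{νμ}(−x)», (5.9) «Σ_μ ∂*_μ Π_{μν}(x − y) = Σ_ν ∂_ν Π_{μν}(x − y) = 0» (the difference
variable of §8(b)).  These are ORIENTATION ONLY: every declaration below is a definition or is proved here from the imported files; no
printed statement is used as a hypothesis.  [folklore] = elementary finite-sum / kernel calculus.
-/

open Finset
open scoped BigOperators
open Literature.Probability.LatticeModels (TorusSite Torus.proj Torus.proj_apply)
open Literature.MathematicalPhysics.QuantumFieldTheory.Balaban1983to89
open Literature.MathematicalPhysics.QuantumFieldTheory.Balaban1983to89.Beta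
open B12Sec2to5 (l1 l1_nonneg Decay510)
open DecimatedMomentSummable (AbsMoment₂)
open DressedMomentNormalisation (EKer m2Tensor)
open HidentScalewise (Tensor4 HessianTelescoping)
open ScalewiseVectorSeam (OneShotFullSum oneShotSide readout122)
open B12Beta (secondMoment)
open ExpKernelCalculus (Decays BiLoc VertexFamily VertexFamily₂ hessKer shiftK BlockCovariant absMoment₂_hessKer l1_sub_triangle
  l1_sub_symm l1_natSmul Zl)
open OneStepResolventKernel (Fib KInv decays_KInv shiftK_KInv wsum biLoc_wsum biLoc_finset_sum wsum_shift LocStencil vertexOf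
  bound_mono biLoc_mono decays_mono JetData TOf absMoment₂_TOf)

namespace Literature.MathematicalPhysics.QuantumFieldTheory.Balaban1983to89.Beta.OneStepKernelFamily

variable {d : ℕ}

/-! ## §1 Block-contour decimation of matrix kernels -/

section Dec

/-- Index set of a FIELD leg of the decimation: block offsets `r ∈ [0,M)^{d+1}` × contour steps `s ∈ [0,M)`. [folklore] -/
def LegIdx (d M : ℕ) : Finset ((Fin (d + 1) → ℕ) × ℕ) :=
  (Fintype.piFinset fun _ : Fin (d + 1) => Finset.range M) ×ˢ Finset.range M

/-- Index finset per leg: field legs run over `LegIdx`, multiplier legs over a single index. [folklore] -/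
def legSet (d M : ℕ) : Fib d → Finset ((Fin (d + 1) → ℕ) × ℕ)
  | Sum.inl _ => LegIdx d M
  | Sum.inr _ => {(fun _ => 0, 0)}

/-- The fine point of a leg index: for a field leg `(κ, x′)` the point `M•x′ + r + s e_κ` of the straight contour of length `M` in
direction `κ` starting in the `M`-block at `M•x′`; for a multiplier leg the coarse point `M•x′`. [folklore] -/
def legPt (M : ℕ) : Fib d → (Fin (d + 1) → ℤ) → ((Fin (d + 1) → ℕ) × ℕ) → (Fin (d + 1) → ℤ)
  | Sum.inl κ, x', i => (M : ℤ) • x' + fun j => ((i.1 j : ℤ) + if j = κ then (i.2 : ℤ) else 0)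
  | Sum.inr _, x', _ => (M : ℤ) • x'

/-- Leg weights: `M^{−(d+2)}` (block mean of the contour mean, the linearised averaging at `U = 1` in the coarse-unit convention
`(1/(L^jη)) Q_j(U, ηA) = Q_j(U)A + …` of B9 (3.14)) for a field leg, `1` for a multiplier leg. [folklore] -/
noncomputable def legW (d M : ℕ) : Fib d → ℝ
  | Sum.inl _ => ((M : ℝ) ^ (d + 2))⁻¹
  | Sum.inr _ => 1

/-- **BLOCK-CONTOUR DECIMATION** of a matrix kernel on the fibre `Fib d` by the factor `M`: field legs are averaged over the
straight contours of the `M`-blocks (the `U = 1` linearised averaging), multiplier legs are read at the coarse points `M•x′`; the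
result is a kernel on the `M`-times coarser lattice, again indexed by `ℤ^{d+1}`. [folklore] -/
noncomputable def dec (M : ℕ) (K : ExpKernelCalculus.MKer (d + 1) (Fib d)) : ExpKernelCalculus.MKer (d + 1) (Fib d) :=
  fun x' y' a b => ∑ i ∈ legSet d M a, ∑ i' ∈ legSet d M b, legW d M a * legW d M b * K (legPt M a x' i) (legPt M b y' i') a b

/-- Leg weights are nonnegative. [folklore] -/
theorem legW_nonneg (M : ℕ) (a : Fib d) : 0 ≤ legW d M a := by
  cases a <;> simp only [legW] <;> positivity

/-- The leg weights are normalised: they sum to `1` over the leg's index set (`M ≠ 0`). [folklore] -/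
theorem sum_legW {M : ℕ} (hM : M ≠ 0) (a : Fib d) : ∑ _i ∈ legSet d M a, legW d M a = 1 := by
  cases a with
  | inl κ =>
      simp only [legSet, legW, Finset.sum_const, nsmul_eq_mul]
      rw [LegIdx, Finset.card_product, Fintype.card_piFinset, Finset.prod_const, Finset.card_univ, Fintype.card_fin,
        Finset.card_range]
      have hM' : (M : ℝ) ≠ 0 := by exact_mod_cast hM
      rw [show (((M ^ (d + 1) * M : ℕ) : ℝ)) = (M : ℝ) ^ (d + 2) by push_cast; ring]
      exact mul_inv_cancel₀ (pow_ne_zero _ hM')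
  | inr κ => simp [legSet, legW]

/-- Translating the coarse point translates every leg point by `M` times as much. [folklore] -/
theorem legPt_add (M : ℕ) (a : Fib d) (x' v : Fin (d + 1) → ℤ) (i : (Fin (d + 1) → ℕ) × ℕ) :
    legPt M a (x' + v) i = legPt M a x' i + (M : ℤ) • v := by
  cases a with
  | inl κ => simp only [legPt, smul_add]; abel
  | inr κ => simp only [legPt, smul_add]

/-- Every leg point lies within `ℓ¹`-distance `2(d+1)M` of the coarse point `M•x′`. [folklore] -/
theorem l1_legPt_sub_le (M : ℕ) (a : Fib d) (x' : Fin (d + 1) → ℤ) {i : (Fin (d + 1) → ℕ) × ℕ} (hi : i ∈ legSet d M a) :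
    l1 (legPt M a x' i - (M : ℤ) • x') ≤ 2 * (d + 1) * M := by
  cases a with
  | inl κ =>
      simp only [legSet, LegIdx, Finset.mem_product, Fintype.mem_piFinset, Finset.mem_range] at hi
      simp only [legPt, add_sub_cancel_left, l1]
      calc ∑ j : Fin (d + 1), |(((fun j => ((i.1 j : ℤ) + if j = κ then (i.2 : ℤ) else 0)) j : ℤ) : ℝ)|
          ≤ ∑ _j : Fin (d + 1), (2 * M : ℝ) := by
            refine Finset.sum_le_sum fun j _ => ?_
            have h1 : ((i.1 j : ℤ) : ℝ) < M := by exact_mod_cast hi.1 j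
            have h2 : ((i.2 : ℤ) : ℝ) < M := by exact_mod_cast hi.2
            by_cases hj : j = κ
            · simp only [hj, if_true, Int.cast_add, Int.cast_natCast]
              rw [abs_of_nonneg (by positivity)]
              have : ((i.1 κ : ℤ) : ℝ) < M := by exact_mod_cast hi.1 κ
              push_cast at this h2 ⊢
              linarith
            · simp only [hj, if_false, add_zero, Int.cast_natCast]
              rw [abs_of_nonneg (by positivity)]
              push_cast at h1 ⊢
              have : (0 : ℝ) ≤ M := by positivity
              linarith
        _ = 2 * (d + 1) * M := by
            rw [Finset.sum_const, Finset.card_univ, Fintype.card_fin, nsmul_eq_mul]; push_cast; ring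
  | inr κ =>
      simp only [legPt, sub_self, l1, Pi.zero_apply, Int.cast_zero, abs_zero, Finset.sum_const_zero]
      positivity

/-- The reverse triangle inequality for the decimation: `|x′ − y′|₁ ≤ |p − q|₁ + 4(d+1)M` for leg points `p`, `q` over `x′`, `y′`
(`M ≥ 1`). [folklore] -/
theorem l1_sub_le_legPt {M : ℕ} (hM : 1 ≤ M) (a b : Fib d) (x' y' : Fin (d + 1) → ℤ) {i i' : (Fin (d + 1) → ℕ) × ℕ}
    (hi : i ∈ legSet d M a) (hi' : i' ∈ legSet d M b) :
    l1 (x' - y') ≤ l1 (legPt M a x' i - legPt M b y' i') + 4 * (d + 1) * M := by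
  set p := legPt M a x' i
  set q := legPt M b y' i'
  have h1 : l1 (x' - y') ≤ l1 ((M : ℤ) • x' - (M : ℤ) • y') := by
    rw [← smul_sub, l1_natSmul]
    have hM' : (1 : ℝ) ≤ M := by exact_mod_cast hM
    have := l1_nonneg (x' - y')
    nlinarith
  have h2 : l1 ((M : ℤ) • x' - (M : ℤ) • y') ≤ l1 ((M : ℤ) • x' - p) + l1 (p - q) + l1 (q - (M : ℤ) • y') :=
    (l1_sub_triangle _ p _).trans (by have := l1_sub_triangle p q ((M : ℤ) • y'); linarith)
  have h3 : l1 ((M : ℤ) • x' - p) ≤ 2 * (d + 1) * M := by rw [l1_sub_symm]; exact l1_legPt_sub_le M a x' hi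
  have h4 : l1 (q - (M : ℤ) • y') ≤ 2 * (d + 1) * M := l1_legPt_sub_le M b y' hi'
  linarith

/-- **DECIMATION PRESERVES EXPONENTIAL DECAY** (same rate on the coarser lattice, constant multiplied by `e^{4δ(d+1)M}`; per `M`).
[folklore] -/
theorem decays_dec {K : ExpKernelCalculus.MKer (d + 1) (Fib d)} {C δ : ℝ} (hK : Decays K C δ) (hC : 0 ≤ C) (hδ : 0 ≤ δ)
    {M : ℕ} (hM : 1 ≤ M) : Decays (dec M K) (C * Real.exp (δ * (4 * (d + 1) * M))) δ := by
  intro x' y' a b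
  have hM0 : M ≠ 0 := by omega
  unfold dec
  calc |∑ i ∈ legSet d M a, ∑ i' ∈ legSet d M b, legW d M a * legW d M b * K (legPt M a x' i) (legPt M b y' i') a b|
      ≤ ∑ i ∈ legSet d M a, ∑ i' ∈ legSet d M b, |legW d M a * legW d M b * K (legPt M a x' i) (legPt M b y' i') a b| := by
        refine (Finset.abs_sum_le_sum_abs _ _).trans (Finset.sum_le_sum fun i _ => Finset.abs_sum_le_sum_abs _ _)
    _ ≤ ∑ i ∈ legSet d M a, ∑ i' ∈ legSet d M b,
          legW d M a * legW d M b * (C * Real.exp (δ * (4 * (d + 1) * M)) * Real.exp (-δ * l1 (x' - y'))) := by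
        refine Finset.sum_le_sum fun i hi => Finset.sum_le_sum fun i' hi' => ?_
        rw [abs_mul, abs_mul, abs_of_nonneg (legW_nonneg M a), abs_of_nonneg (legW_nonneg M b)]
        refine mul_le_mul_of_nonneg_left ?_ (mul_nonneg (legW_nonneg M a) (legW_nonneg M b))
        refine (hK _ _ a b).trans ?_
        rw [mul_assoc, ← Real.exp_add]
        refine mul_le_mul_of_nonneg_left (Real.exp_le_exp.2 ?_) hC
        have := l1_sub_le_legPt hM a b x' y' hi hi'
        nlinarith
    _ = (∑ _i ∈ legSet d M a, legW d M a) * (∑ _i' ∈ legSet d M b, legW d M b) *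
          (C * Real.exp (δ * (4 * (d + 1) * M)) * Real.exp (-δ * l1 (x' - y'))) := by
        rw [Finset.sum_mul_sum, Finset.sum_mul]
        exact Finset.sum_congr rfl fun i _ => by rw [Finset.sum_mul]
    _ = C * Real.exp (δ * (4 * (d + 1) * M)) * Real.exp (-δ * l1 (x' - y')) := by
        rw [sum_legW hM0 a, sum_legW hM0 b]
        ring

/-- Packaged: a decaying kernel decimates to a decaying kernel. [folklore] -/
theorem decays_dec' {K : ExpKernelCalculus.MKer (d + 1) (Fib d)} (hK : ∃ δ C : ℝ, 0 < δ ∧ 0 ≤ C ∧ Decays K C δ) {M : ℕ}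
    (hM : 1 ≤ M) : ∃ δ C : ℝ, 0 < δ ∧ 0 ≤ C ∧ Decays (dec M K) C δ := by
  obtain ⟨δ, C, hδ, hC, h⟩ := hK
  exact ⟨δ, _, hδ, by positivity, decays_dec h hC hδ.le hM⟩

/-- **DECIMATION INTERTWINES TRANSLATIONS**: a shift by `v` on the coarse lattice is a shift by `M•v` on the fine one. [folklore] -/
theorem shiftK_dec (M : ℕ) (K : ExpKernelCalculus.MKer (d + 1) (Fib d)) (v : Fin (d + 1) → ℤ) :
    shiftK v (dec M K) = dec M (shiftK ((M : ℤ) • v) K) := by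
  funext x' y' a b
  simp only [shiftK, dec, legPt_add]

/-- Multiplier legs of the decimated kernel vanish wherever the fine kernel's multiplier legs vanish at `M•x′`. [folklore] -/
theorem dec_inr_left (M : ℕ) (K : ExpKernelCalculus.MKer (d + 1) (Fib d)) (κ : Fin (d + 1)) (b : Fib d)
    (x' y' : Fin (d + 1) → ℤ) (hK : ∀ q, K ((M : ℤ) • x') q (Sum.inr κ) b = 0) : dec M K x' y' (Sum.inr κ) b = 0 := by
  simp only [dec, legSet, legPt, hK, mul_zero, Finset.sum_const_zero]

end Dec

/-! ## §2 The decimated composite resolvent: the propagator of the GENUINE step-`j` system -/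

section Step

variable {Lc : ℕ} [NeZero Lc]

/-- **THE DECIMATED COMPOSITE RESOLVENT** `KInvStep Lc j` := the block-contour decimation by `Lc^j` of the packed resolvent
`KInv (Lc^(j+1))` of the `(j+1)`-step composite system at `U = 1`.  Its field legs live on the step-`j` lattice, its multiplier
legs at the `Lc`-coarse points of that lattice — the SHAPE of a one-step resolvent of blocking `Lc` on the step-`j` lattice.
READING (to be PROVED as part of the telescoping algebra, not asserted here): at `U = 1` the marginal of the averaged field
`A_j = Q_{Lc^j} A` under the `(j+1)`-step composite constrained Gaussian is the step-`j` fluctuation measure, so the blocks of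
`KInvStep Lc j` are the fluctuation covariance, the minimiser and the multiplier response of the GENUINE step-`j` system (quadratic
form = the `j`-step effective operator, B12 (1.20)).  [folklore] -/
noncomputable def KInvStep (Lc : ℕ) [NeZero Lc] (j : ℕ) : ExpKernelCalculus.MKer (d + 1) (Fib d) :=
  dec (Lc ^ j) (KInv (N := Lc ^ (j + 1)) (d := d))

/-- The decimated composite resolvent decays exponentially (per `Lc`, `j`). [folklore] -/
theorem decays_KInvStep (j : ℕ) : ∃ δ C : ℝ, 0 < δ ∧ 0 ≤ C ∧ Decays (KInvStep (d := d) Lc j) C δ :=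
  decays_dec' (decays_KInv (N := Lc ^ (j + 1)) (d := d)) (Nat.one_le_iff_ne_zero.2 (pow_ne_zero _ (NeZero.ne Lc)))

/-- **BLOCK COVARIANCE** of the decimated composite resolvent under the `Lc`-translations of the step-`j` lattice
(`BlockCovariant.covA` at blocking `Lc`). [folklore] -/
theorem shiftK_KInvStep (j : ℕ) (t : Fin (d + 1) → ℤ) :
    shiftK (-((Lc : ℤ) • t)) (KInvStep (d := d) Lc j) = KInvStep (d := d) Lc j := by
  unfold KInvStep
  rw [shiftK_dec]
  have h : ((Lc ^ j : ℕ) : ℤ) • (-((Lc : ℤ) • t)) = -(((Lc ^ (j + 1) : ℕ) : ℤ) • t) := by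
    rw [smul_neg, smul_smul]; push_cast; ring_nf
  rw [h, shiftK_KInv]

/-- The coarse points of the step-`j` lattice: `proj (Lc^(j+1)) (Lc^j • x′) = 0 ↔ proj Lc x′ = 0`. [folklore] -/
theorem proj_pow_smul_eq_zero_iff (j : ℕ) (x' : Fin (d + 1) → ℤ) :
    Torus.proj (Lc ^ (j + 1)) (((Lc ^ j : ℕ) : ℤ) • x') = 0 ↔ Torus.proj Lc x' = 0 := by
  have hL : ((Lc ^ j : ℕ) : ℤ) ≠ 0 := by exact_mod_cast pow_ne_zero _ (NeZero.ne Lc)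
  constructor
  · intro h
    funext i
    have hi := congrFun h i
    simp only [Torus.proj_apply, Pi.smul_apply, smul_eq_mul, Pi.zero_apply] at hi ⊢
    rw [ZMod.intCast_zmod_eq_zero_iff_dvd] at hi ⊢
    rw [show ((Lc ^ (j + 1) : ℕ) : ℤ) = ((Lc ^ j : ℕ) : ℤ) * (Lc : ℤ) by push_cast; ring] at hi
    exact (mul_dvd_mul_iff_left hL).1 hi
  · intro h
    funext i
    have hi := congrFun h i
    simp only [Torus.proj_apply, Pi.smul_apply, smul_eq_mul, Pi.zero_apply] at hi ⊢
    rw [ZMod.intCast_zmod_eq_zero_iff_dvd] at hi ⊢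
    rw [show ((Lc ^ (j + 1) : ℕ) : ℤ) = ((Lc ^ j : ℕ) : ℤ) * (Lc : ℤ) by push_cast; ring]
    exact (mul_dvd_mul_iff_left hL).2 hi

/-- Multiplier legs of `KInvStep Lc j` vanish off the `Lc`-coarse points of the step-`j` lattice. [folklore] -/
theorem KInvStep_inr_off (j : ℕ) {x' : Fin (d + 1) → ℤ} (hx : Torus.proj Lc x' ≠ 0) (κ : Fin (d + 1)) (b : Fib d)
    (y' : Fin (d + 1) → ℤ) : KInvStep (d := d) Lc j x' y' (Sum.inr κ) b = 0 := by
  refine dec_inr_left _ _ κ b x' y' (fun q => OneStepResolventKernel.KInv_inr_off (N := Lc ^ (j + 1)) ?_ κ b q)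
  rwa [Ne, proj_pow_smul_eq_zero_iff]

end Step

/-! ## §3 Chain-rule vertices through the `ℋ`-column of an arbitrary packed resolvent -/

section VertexK

variable {N : ℕ}

/-- The `ℋ`-COLUMN of a packed kernel at the coarse bond `(μ, y)`: `u, κ′ ↦ K u (N•y) (inl κ′) (inr μ)` (for `K = KInv N` this is
`wH κ′ μ (u − N•y)`, `OneStepResolventKernel.vertexOf_weight`). [folklore] -/
def colH (K : ExpKernelCalculus.MKer (d + 1) (Fib d)) (N : ℕ) (μ : Fin (d + 1)) (y : Fin (d + 1) → ℤ) (κ' : Fin (d + 1))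
    (u : Fin (d + 1) → ℤ) : ℝ :=
  K u ((N : ℤ) • y) (Sum.inl κ') (Sum.inr μ)

/-- The `ℋ`-column of a decaying kernel decays from the coarse point. [folklore] -/
theorem abs_colH_le {K : ExpKernelCalculus.MKer (d + 1) (Fib d)} {C δ : ℝ} (hK : Decays K C δ) (μ : Fin (d + 1))
    (y : Fin (d + 1) → ℤ) (κ' : Fin (d + 1)) (u : Fin (d + 1) → ℤ) :
    |colH K N μ y κ' u| ≤ C * Real.exp (-δ * l1 (u - (N : ℤ) • y)) :=
  hK _ _ _ _

/-- **THE CHAIN-RULE VERTEX THROUGH AN ARBITRARY PACKED RESOLVENT** `K`: `V μ y := Σ_{κ′} Σ'_u K u (N•y) (inl κ′) (inr μ) · S κ′ u`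
— the first `B`-jet at the coarse bond `(μ, y)` of an operator depending on the background through the field, when the background's
linear response is the `ℋ`-column of `K`. [folklore] -/
noncomputable def vertexOfK (K : ExpKernelCalculus.MKer (d + 1) (Fib d)) (N : ℕ)
    (S : Fin (d + 1) → (Fin (d + 1) → ℤ) → ExpKernelCalculus.MKer (d + 1) (Fib d)) (μ : Fin (d + 1)) (y : Fin (d + 1) → ℤ) :
    ExpKernelCalculus.MKer (d + 1) (Fib d) :=
  fun x z a b => ∑ κ' : Fin (d + 1), wsum (colH K N μ y κ') (S κ') x z a b

/-- For the one-step resolvent the general constructor is the one of `OneStepResolventKernel`. [folklore] -/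
theorem vertexOfK_KInv [NeZero N] (S : Fin (d + 1) → (Fin (d + 1) → ℤ) → ExpKernelCalculus.MKer (d + 1) (Fib d))
    (μ : Fin (d + 1)) (y : Fin (d + 1) → ℤ) : vertexOfK (KInv (N := N)) N S μ y = vertexOf (N := N) S μ y := by
  funext x z a b
  simp only [vertexOfK, vertexOf]
  refine Finset.sum_congr rfl fun κ' _ => ?_
  have hw : colH (KInv (N := N)) N μ y κ' = fun u => KernelSpecInstance.wH (N := N) κ' μ (u - (N : ℤ) • y) :=
    funext fun u => (OneStepResolventKernel.vertexOf_weight (N := N) κ' μ u y).symm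
  rw [hw]

/-- **THE CHAIN-RULE VERTEX IS A VERTEX FAMILY** for any decaying `K` and any local stencil family. [folklore] -/
theorem vertexFamily_vertexOfK {K : ExpKernelCalculus.MKer (d + 1) (Fib d)} {C δK : ℝ} (hK : Decays K C δK) (hC : 0 ≤ C)
    {S : Fin (d + 1) → (Fin (d + 1) → ℤ) → ExpKernelCalculus.MKer (d + 1) (Fib d)} {Cs δ : ℝ} (hS : LocStencil S Cs δ)
    (hδ : 0 < δ) (hδK : δ ≤ δK) :
    VertexFamily (vertexOfK K N S) N ((d + 1 : ℕ) * (C * Cs * Zl (d + 1) (δ / 2))) (δ / 2) := by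
  intro μ y
  have hterm : ∀ κ' : Fin (d + 1), BiLoc (wsum (colH K N μ y κ') (S κ')) ((N : ℤ) • y) ((N : ℤ) • y)
      (C * Cs * Zl (d + 1) (δ / 2)) (δ / 2) := by
    intro κ'
    refine biLoc_wsum (fun u => ?_) (fun u => hS κ' u) hδ hC
    exact bound_mono (abs_colH_le (N := N) hK μ y κ' u) hC le_rfl hδK (l1_nonneg _)
  have hsum := biLoc_finset_sum (Finset.univ : Finset (Fin (d + 1))) (fun κ' _ => hterm κ')
  simp only [Finset.sum_const, Finset.card_univ, Fintype.card_fin, nsmul_eq_mul] at hsum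
  exact hsum

/-- Packaged form with matched rates. [folklore] -/
theorem vertexFamily_vertexOfK' {K : ExpKernelCalculus.MKer (d + 1) (Fib d)} (hK : ∃ δ C : ℝ, 0 < δ ∧ 0 ≤ C ∧ Decays K C δ)
    {S : Fin (d + 1) → (Fin (d + 1) → ℤ) → ExpKernelCalculus.MKer (d + 1) (Fib d)} {Cs δ : ℝ} (hS : LocStencil S Cs δ)
    (hδ : 0 < δ) : ∃ Cv δv : ℝ, 0 < δv ∧ VertexFamily (vertexOfK K N S) N Cv δv := by
  obtain ⟨δK, C, hδK, hC, h⟩ := hK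
  have hCs : 0 ≤ Cs := (hS 0 0).nonneg (Sum.inl 0)
  have hS' : LocStencil S Cs (min δ δK) := fun κ' u => biLoc_mono (hS κ' u) hCs (min_le_left _ _)
  exact ⟨_, _, half_pos (lt_min hδ hδK), vertexFamily_vertexOfK (N := N) h hC hS' (lt_min hδ hδK) (min_le_right _ _)⟩

/-- The `ℋ`-column weights of a block-covariant kernel are translated with the coarse bond. [folklore] -/
theorem colH_translate {K : ExpKernelCalculus.MKer (d + 1) (Fib d)} (hKs : ∀ t, shiftK (-((N : ℤ) • t)) K = K)
    (μ : Fin (d + 1)) (y t : Fin (d + 1) → ℤ) (κ' : Fin (d + 1)) (u : Fin (d + 1) → ℤ) :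
    colH K N μ (y + t) κ' u = colH K N μ y κ' (u - (N : ℤ) • t) := by
  have h := congrFun (congrFun (congrFun (congrFun (hKs t) u) ((N : ℤ) • (y + t))) (Sum.inl κ')) (Sum.inr μ)
  simp only [shiftK] at h
  simp only [colH]
  rw [← h, smul_add, ← sub_eq_add_neg, ← sub_eq_add_neg, add_sub_cancel_right]

/-- **COVARIANCE OF THE CHAIN-RULE VERTEX** (`BlockCovariant.covV`) for a block-covariant `K` and a fine-translation-covariant
stencil family. [folklore] -/
theorem vertexOfK_translate {K : ExpKernelCalculus.MKer (d + 1) (Fib d)} (hKs : ∀ t, shiftK (-((N : ℤ) • t)) K = K)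
    {S : Fin (d + 1) → (Fin (d + 1) → ℤ) → ExpKernelCalculus.MKer (d + 1) (Fib d)}
    (hS : ∀ (κ' : Fin (d + 1)) (u v : Fin (d + 1) → ℤ), S κ' (u + v) = shiftK (-v) (S κ' u)) (μ : Fin (d + 1))
    (y t : Fin (d + 1) → ℤ) : vertexOfK K N S μ (y + t) = shiftK (-((N : ℤ) • t)) (vertexOfK K N S μ y) := by
  funext x z a b
  simp only [vertexOfK]
  have h : ∀ κ' : Fin (d + 1), wsum (colH K N μ (y + t) κ') (S κ') = shiftK (-((N : ℤ) • t)) (wsum (colH K N μ y κ') (S κ')) := by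
    intro κ'
    have hw : colH K N μ (y + t) κ' = fun u => colH K N μ y κ' (u - (N : ℤ) • t) := funext (colH_translate hKs μ y t κ')
    rw [hw]
    exact wsum_shift (colH K N μ y κ') ((N : ℤ) • t) (fun u => hS κ' u ((N : ℤ) • t))
  simp only [h, shiftK, vertexOfK]

end VertexK

/-! ## §4 Well-typedness of the resolvent Hessian kernel over ANY decaying packed resolvent -/

section Hess

variable {N : ℕ}

/-- `AbsMoment₂ (hessKer K V W μ ν)` for any decaying `K`, any vertex pair bi-localised at the coarse bonds (rates matched by
monotonicity), `1 ≤ N`. [folklore] -/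
theorem absMoment₂_hessKer_of_decays {K : ExpKernelCalculus.MKer (d + 1) (Fib d)} (hK : ∃ δ C : ℝ, 0 < δ ∧ 0 ≤ C ∧ Decays K C δ)
    {V : Fin (d + 1) → (Fin (d + 1) → ℤ) → ExpKernelCalculus.MKer (d + 1) (Fib d)}
    {W : Fin (d + 1) → (Fin (d + 1) → ℤ) → Fin (d + 1) → (Fin (d + 1) → ℤ) → ExpKernelCalculus.MKer (d + 1) (Fib d)}
    {Cv Cw δv : ℝ} (hV : VertexFamily V N Cv δv) (hW : VertexFamily₂ W N Cw δv) (hδv : 0 < δv) (hN : 1 ≤ N)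
    (μ ν : Fin (d + 1)) : AbsMoment₂ (hessKer K V W μ ν) := by
  obtain ⟨δK, C, hδK, hC, h⟩ := hK
  have hCv : 0 ≤ Cv := (hV μ 0).nonneg (Sum.inl 0)
  have hCw : 0 ≤ Cw := (hW μ 0 ν 0).nonneg (Sum.inl 0)
  have hK' : Decays K C (min δK δv) := decays_mono h hC le_rfl (min_le_left _ _)
  have hV' : VertexFamily V N Cv (min δK δv) := fun μ' y => biLoc_mono (hV μ' y) hCv (min_le_right _ _)
  have hW' : VertexFamily₂ W N Cw (min δK δv) := fun μ' y ν' y' => biLoc_mono (hW μ' y ν' y') hCw (min_le_right _ _)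
  exact absMoment₂_hessKer hK' hV' hW' (lt_min hδK hδv) hN μ ν

end Hess

/-! ## §5 The typed one-step kernel of the GENUINE step-`j` system from jet data, and the `hTA` slot -/

section StepKernel

variable {Lc : ℕ} [NeZero Lc]

/-- **THE TYPED STEP-`j` KERNEL OF A JET DATUM** (blocking `Lc` on the step-`j` lattice): the resolvent Hessian kernel of the
decimated composite resolvent `KInvStep Lc j` with the chain-rule first-order vertex through ITS `ℋ`-column and the given
second-order vertex family.  Bałaban's step-`j` jets (the `B_j`-derivatives of the `j`-step effective form and of one averaging)
are NOT constructed here; `J` is the socket. [folklore] -/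
noncomputable def TstepOf (Lc : ℕ) [NeZero Lc] (j : ℕ) (J : JetData d Lc) : Fin (d + 1) → Fin (d + 1) → (Fin (d + 1) → ℤ) → ℝ :=
  hessKer (KInvStep (d := d) Lc j) (vertexOfK (KInvStep (d := d) Lc j) Lc J.S) J.W

/-- Every entry of the typed step-`j` kernel has absolutely summable second moments. [folklore] -/
theorem absMoment₂_TstepOf (j : ℕ) (J : JetData d Lc) (μ ν : Fin (d + 1)) : AbsMoment₂ (TstepOf Lc j J μ ν) := by
  have hK := decays_KInvStep (d := d) (Lc := Lc) j
  obtain ⟨Cv, δv, hδv, hV⟩ := vertexFamily_vertexOfK' (N := Lc) hK J.loc J.δ_pos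
  have hCv : 0 ≤ Cv := (hV μ 0).nonneg (Sum.inl 0)
  have hCw : 0 ≤ J.Cw := (J.loc₂ μ 0 ν 0).nonneg (Sum.inl 0)
  have hV' : VertexFamily (vertexOfK (KInvStep (d := d) Lc j) Lc J.S) Lc Cv (min δv J.δ) :=
    fun μ' y => biLoc_mono (hV μ' y) hCv (min_le_left _ _)
  have hW' : VertexFamily₂ J.W Lc J.Cw (min δv J.δ) := fun μ' y ν' y' => biLoc_mono (J.loc₂ μ' y ν' y') hCw (min_le_right _ _)
  exact absMoment₂_hessKer_of_decays hK hV' hW' (lt_min hδv J.δ_pos) (Nat.one_le_iff_ne_zero.2 (NeZero.ne Lc)) μ ν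

/-- **THE `hTA` SLOT FOR THE ONE-STEP FAMILY IN DIMENSION FOUR**: for any scale-indexed family of step jet data (blocking `Lc` on
each step lattice), `j ↦ TstepOf Lc j (J j) : ℕ → EKer 4` satisfies `hTA` of the endpoint theorems. [folklore] -/
theorem hTA_TstepOf (J : ℕ → JetData 3 Lc) : ∀ (j : ℕ) (c e : Fin 4), AbsMoment₂ ((fun j => (TstepOf Lc j (J j) : EKer 4)) j c e) :=
  fun j c e => absMoment₂_TstepOf j (J j) c e

end StepKernel

/-! ## §6 The kernel families over jet data and the two EXIT-B predicates (read-out = `ScalewiseVectorSeam.readout122` by name) -/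

section Families

variable {Lc : ℕ} [NeZero Lc]

/-- **THE ONE-STEP KERNEL FAMILY** `Tbal` over step jet data: `j ↦ TstepOf Lc j (Js j)`. [folklore] -/
noncomputable def TbalOf (Lc : ℕ) [NeZero Lc] (Js : ℕ → JetData 3 Lc) : ℕ → EKer 4 := fun j => TstepOf Lc j (Js j)

/-- **THE ONE-SHOT KERNEL FAMILY** `𝒯bal` over composite jet data: `m ↦ TOf (N := Lc^m) (Jc m)` — the resolvent Hessian kernel of the
`m`-step composite system at `U = 1` with the composite jets. [folklore] -/
noncomputable def TshotOf (Lc : ℕ) [NeZero Lc] (Jc : ∀ m : ℕ, JetData 3 (Lc ^ m)) : ℕ → EKer 4 :=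
  fun m => TOf (N := Lc ^ m) (Jc m)

/-- `hTA` for the one-step family. [folklore] -/
theorem hTA_TbalOf (Js : ℕ → JetData 3 Lc) : ∀ (j : ℕ) (c e : Fin 4), AbsMoment₂ (TbalOf Lc Js j c e) :=
  hTA_TstepOf Js

/-- `AbsMoment₂` for the one-shot family. [folklore] -/
theorem absMoment₂_TshotOf (Jc : ∀ m : ℕ, JetData 3 (Lc ^ m)) (m : ℕ) (c e : Fin 4) : AbsMoment₂ (TshotOf Lc Jc m c e) :=
  absMoment₂_TOf (N := Lc ^ m) (Jc m) c e

/-- **EXIT-B PREDICATE (D1-tel) OVER JET DATA**: Hessian telescoping of the one-step family onto the one-shot family — by the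
cell's ruling this is KKT-composition ALGEBRA (chain rule + composition law + vanishing first variations) once the jets are
Bałaban's; here a predicate over the jet parameters, never a fact. [folklore] -/
def D1Tel (Lc : ℕ) [NeZero Lc] (Js : ℕ → JetData 3 Lc) (Jc : ∀ m : ℕ, JetData 3 (Lc ^ m)) : Prop :=
  HessianTelescoping Lc (TbalOf Lc Js) (TshotOf Lc Jc)

/-- **EXIT-B PREDICATE (D1-rep) OVER JET DATA**, in the PRINTED read-out form of `ScalewiseVectorSeam` §5 (the read-out IS
`ScalewiseVectorSeam.readout122 μ ν` by name, `readout122_m2Tensor`): the (1.22) second moment of the one-shot kernel of the `m`-step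
composite system stays within an `m`-UNIFORM constant of the free full sums `oneShotSide` at every scale `Lc^m` — ALL the analytic
content of (D1); a predicate over the jet parameters, never a fact. [folklore] -/
def D1Rep {L : Type*} (Lc : ℕ) [NeZero Lc] (Jc : ∀ m : ℕ, JetData 3 (Lc ^ m)) (N : ℝ) (μ ν : Fin 4) (a : ℝ) (SL : Finset L)
    (k : L → Fin 4) : Prop :=
  ∃ U : ℝ, ∀ m : ℕ, 1 ≤ m → |secondMoment (TshotOf Lc Jc m) μ ν - oneShotSide SL μ ν N a k (Lc ^ m)| ≤ U

/-- `D1Rep` is `∃ U, OneShotFullSum Lc (readout122 μ ν) (TshotOf Lc Jc) …` (the socket's form). [folklore] -/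
theorem d1Rep_iff_oneShotFullSum {L : Type*} {Lc : ℕ} [NeZero Lc] {Jc : ∀ m : ℕ, JetData 3 (Lc ^ m)} {N : ℝ} {μ ν : Fin 4}
    {a : ℝ} {SL : Finset L} {k : L → Fin 4} :
    D1Rep Lc Jc N μ ν a SL k ↔ ∃ U : ℝ, OneShotFullSum Lc (readout122 μ ν) (TshotOf Lc Jc) N μ ν a SL k U := by
  simp only [D1Rep, ScalewiseVectorSeam.oneShotFullSum_readout122_iff]

end Families

/-! ## §7 EXIT-B ⇒ END: the endpoint theorem over jet data -/

section Endpoint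

open FlowStep FlowStepRuns DagBinding
open Literature.MathematicalPhysics.QuantumFieldTheory.Balaban1983to89.Beta.VectorTailsLoc (fam kfam)
open Literature.MathematicalPhysics.QuantumFieldTheory.Balaban1983to89.Beta.RemainderChain (RemainderConst)
open Literature.MathematicalPhysics.QuantumFieldTheory.Balaban1983to89.Beta.VectorLegVolumeAdapter (MvE)
open Literature.MathematicalPhysics.QuantumFieldTheory.Balaban1983to89.Beta.ScalewiseVectorSeam
  (endpointExistence_of_scalewise_vectorSeam_readout122_of_symmetries)

variable {L : Type*}

/-- **THE ENDPOINT THEOREM OVER JET DATA (shape certificate of EXIT-B).**  For step jet data `Js` and composite jet data `Jc`: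
IF the one-step family `TbalOf Lc Js` has the printed symmetries (`hdiv`: lattice transversality, `hinv`: bond-reflection
invariance — the cell's replacements of `(T0)/(T1)`), the split's one-loop numbers ARE its printed (1.22) second moments (`hβ`), the
telescoping predicate `D1Tel Lc Js Jc` and the representation predicate `D1Rep Lc Jc N μ ν a SL k` hold, and the cell's standing
hypotheses of `ScalewiseVectorSeam.endpointExistence_of_scalewise_vectorSeam_readout122_of_symmetries` hold, THEN
`EndpointExistence Cn`.  This is that theorem with `T := TbalOf Lc Js`, `𝒯 := TshotOf Lc Jc`, its `hTA` DISCHARGED here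
(`hTA_TbalOf`); every other binder is passed through verbatim.  It discharges nothing of `BetaPertH` by itself: `D1Tel`, `D1Rep`,
`hdiv`, `hinv`, `hβ` (for Bałaban's jets) are exactly what remains. [folklore] -/
theorem endpointExistence_of_D1 (a : ℝ) (ha : 0 < a)
    (h12 : B5.Prop12Printed (fam (fun i : ℕ+ × ℕ => ((i.1 : ℕ+) : ℕ)) (fun i => i.1.pos) MvE a ha))
    (h126 : B5.Kernel126_127Printed (kfam (fun i : ℕ+ × ℕ => ((i.1 : ℕ+) : ℕ)) MvE))
    {SL : Finset L} (hSL : SL.Nonempty) (k : L → Fin 4) {μ ν : Fin 4}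
    {β : HBeta} {Cn : B12.Construction} (hgen : ForwardGenerated Cn β)
    (Sβ : B12Beta.OneLoopSplit β) (hμν : μ ≠ ν) {N : ℝ} (hN : N ≠ 0) {Lc : ℕ} [NeZero Lc] (hL : 2 ≤ Lc)
    (Js : ℕ → JetData 3 Lc) (Jc : ∀ m : ℕ, JetData 3 (Lc ^ m))
    (hdiv : ∀ j (ν' : Fin 4) (x : Fin 4 → ℤ), ∑ μ', (TbalOf Lc Js j μ' ν' x - TbalOf Lc Js j μ' ν' (x - Pi.single μ' 1)) = 0)
    (hinv : ∀ j (μ' ν' : Fin 4) (y : Fin 4 → ℤ),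
      TbalOf Lc Js j μ' ν' ((Pi.single ν' 1 - Pi.single μ' 1) - y) = TbalOf Lc Js j μ' ν' y)
    (hβ : ∀ j, Sβ.β0 j = secondMoment (TbalOf Lc Js j) μ ν) (htel : D1Tel Lc Js Jc)
    {cc : ℝ} {M : ℕ → ℕ}
    (hc : 1 ≤ cc) (hM : ∀ L : ℕ, 2 ≤ L → 1 ≤ M L ∧ (L : ℝ) ≤ cc * M L) (hML : ∀ L : ℕ, 2 ≤ L → M L ≤ L)
    (hrep : D1Rep Lc Jc N μ ν a SL k)
    {rr γ₀ β' : ℝ} (hγ₀ : 0 < γ₀) (hrem : RemainderConst Sβ γ₀ rr) (hr : rr ≤ B12Normalization.stepBal N Lc)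
    (hβ' : 0 ≤ β') (hcont : BetaContH γ₀ β) (hup : BetaUpperH β' γ₀ β) : EndpointExistence Cn := by
  obtain ⟨U, hU⟩ := hrep
  exact endpointExistence_of_scalewise_vectorSeam_readout122_of_symmetries a ha h12 h126 hSL k hgen Sβ hμν hN hL (TbalOf Lc Js)
    (TshotOf Lc Jc) (hTA_TbalOf Js) hdiv hinv hβ htel hc hM hML hU hγ₀ hrem hr hβ' hcont hup

end Endpoint

/-! ## §8 The `hdec` slot: UNIFORM (5.10)-type decay of the typed kernels for every jet datum, and the endpoint theorem over jet
data in the PRINTED-PROPERTIES form (`ScalewiseVectorSeam` §6) -/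

section HDec

variable {N : ℕ}

/-- `hdec` for the resolvent Hessian kernel over ANY decaying packed resolvent and any vertex pair (rates matched by monotonicity):
the lead's `ExpKernelCalculus.hdec_hessKer` with the three rates equalised. [folklore] -/
theorem hdec_hessKer_of_decays {K : ExpKernelCalculus.MKer (d + 1) (Fib d)} (hK : ∃ δ C : ℝ, 0 < δ ∧ 0 ≤ C ∧ Decays K C δ)
    {V : Fin (d + 1) → (Fin (d + 1) → ℤ) → ExpKernelCalculus.MKer (d + 1) (Fib d)}
    {W : Fin (d + 1) → (Fin (d + 1) → ℤ) → Fin (d + 1) → (Fin (d + 1) → ℤ) → ExpKernelCalculus.MKer (d + 1) (Fib d)}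
    {Cv Cw δv : ℝ} (hV : VertexFamily V N Cv δv) (hW : VertexFamily₂ W N Cw δv) (hδv : 0 < δv) (hN : 1 ≤ N) :
    ∃ C' δ' : ℝ, 0 < δ' ∧ ∀ μ ν : Fin (d + 1), Decay510 (hessKer K V W μ ν) C' δ' := by
  obtain ⟨δK, C, hδK, hC, h⟩ := hK
  have hCv : 0 ≤ Cv := (hV 0 0).nonneg (Sum.inl 0)
  have hCw : 0 ≤ Cw := (hW 0 0 0 0).nonneg (Sum.inl 0)
  exact ExpKernelCalculus.hdec_hessKer (decays_mono h hC le_rfl (min_le_left _ _))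
    (fun μ' y => biLoc_mono (hV μ' y) hCv (min_le_right _ _))
    (fun μ' y ν' y' => biLoc_mono (hW μ' y ν' y') hCw (min_le_right _ _)) (lt_min hδK hδv) hN

/-- **`hdec` FOR THE ONE-SHOT KERNEL OF A JET DATUM** (`OneStepResolventKernel.TOf`): a uniform exponential decay of every entry,
for every jet datum — the per-step `hdec` binder of `ScalewiseVectorSeam.endpointExistence_of_scalewise_vectorSeam_printed`. [folklore] -/
theorem hdec_TOf [NeZero N] (J : JetData d N) : ∃ C δ : ℝ, 0 < δ ∧ ∀ μ ν : Fin (d + 1), Decay510 (TOf (N := N) J μ ν) C δ := by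
  obtain ⟨Cv, δv, hδv, hV⟩ := OneStepResolventKernel.vertexFamily_vertexOf' (N := N) J.loc J.δ_pos
  have hCv : 0 ≤ Cv := (hV 0 0).nonneg (Sum.inl 0)
  have hCw : 0 ≤ J.Cw := (J.loc₂ 0 0 0 0).nonneg (Sum.inl 0)
  have hV' : VertexFamily (vertexOf (N := N) J.S) N Cv (min δv J.δ) := fun μ' y => biLoc_mono (hV μ' y) hCv (min_le_left _ _)
  have hW' : VertexFamily₂ J.W N J.Cw (min δv J.δ) := fun μ' y ν' y' => biLoc_mono (J.loc₂ μ' y ν' y') hCw (min_le_right _ _)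
  exact hdec_hessKer_of_decays (decays_KInv (N := N) (d := d)) hV' hW' (lt_min hδv J.δ_pos)
    (Nat.one_le_iff_ne_zero.2 (NeZero.ne N))

variable {Lc : ℕ} [NeZero Lc]

/-- **`hdec` FOR THE TYPED STEP-`j` KERNEL OF A JET DATUM.** [folklore] -/
theorem hdec_TstepOf (j : ℕ) (J : JetData d Lc) :
    ∃ C δ : ℝ, 0 < δ ∧ ∀ μ ν : Fin (d + 1), Decay510 (TstepOf Lc j J μ ν) C δ := by
  have hK := decays_KInvStep (d := d) (Lc := Lc) j
  obtain ⟨Cv, δv, hδv, hV⟩ := vertexFamily_vertexOfK' (N := Lc) hK J.loc J.δ_pos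
  have hCv : 0 ≤ Cv := (hV 0 0).nonneg (Sum.inl 0)
  have hCw : 0 ≤ J.Cw := (J.loc₂ 0 0 0 0).nonneg (Sum.inl 0)
  have hV' : VertexFamily (vertexOfK (KInvStep (d := d) Lc j) Lc J.S) Lc Cv (min δv J.δ) :=
    fun μ' y => biLoc_mono (hV μ' y) hCv (min_le_left _ _)
  have hW' : VertexFamily₂ J.W Lc J.Cw (min δv J.δ) := fun μ' y ν' y' => biLoc_mono (J.loc₂ μ' y ν' y') hCw (min_le_right _ _)
  exact hdec_hessKer_of_decays hK hV' hW' (lt_min hδv J.δ_pos) (Nat.one_le_iff_ne_zero.2 (NeZero.ne Lc))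

/-- `hdec` for the one-step family over step jet data, in the exact shape of the printed endpoint theorem's binder. [folklore] -/
theorem hdec_TbalOf (Js : ℕ → JetData 3 Lc) :
    ∀ j : ℕ, ∃ C δ : ℝ, 0 < δ ∧ ∀ μ' ν' : Fin 4, Decay510 (TbalOf Lc Js j μ' ν') C δ :=
  fun j => hdec_TstepOf j (Js j)

/-- `hdec` for the one-shot family over composite jet data. [folklore] -/
theorem hdec_TshotOf (Jc : ∀ m : ℕ, JetData 3 (Lc ^ m)) :
    ∀ m : ℕ, ∃ C δ : ℝ, 0 < δ ∧ ∀ μ' ν' : Fin 4, Decay510 (TshotOf Lc Jc m μ' ν') C δ :=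
  fun m => hdec_TOf (N := Lc ^ m) (Jc m)

end HDec

section Flip

open Literature.MathematicalPhysics.QuantumFieldTheory.Balaban1983to89.B6BondElimination (unitVec)
open Literature.MathematicalPhysics.QuantumFieldTheory.Balaban1983to89.Beta.PolarizationSign
  (WardTransversal AxisReflectionCovariant axisReflect axisReflect_apply reflSign)

variable {D : ℕ}

/-- **THE PRINTED DIFFERENCE VARIABLE.**  `flipK T μ ν z := T μ ν (−z)`: a matrix kernel read in the OPPOSITE difference variable.
WHY IT IS HERE (a convention, located by this file; nothing about Bałaban's kernels is asserted): the resolvent Hessian kernel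
`ExpKernelCalculus.hessKer A V W μ ν z` — hence `TOf`, `TstepOf`, `TbalOf`, `TshotOf` — carries the difference variable
`z = (base point of the SECOND bond (ν)) − (base point of the FIRST bond (μ))` (`ExpKernelCalculus.hess_eq_hessKer`:
`hess μ y ν y′ = hessKer μ ν (y′ − y)`), whereas [Balaban1987RG1] p. 293 (5.8) «Π_{μν}(x, y) = Π_{μν}(x − y)» (with (5.4)/(5.7) ibid.:
the first index `μ` sits on the bond `⟨x, x + e_μ⟩`) takes FIRST minus second.  The printed symmetry properties (5.7) (reflection
covariance) and (5.9) (the Ward identity `Σ_μ ∂*_μ Π_{μν}(x − y) = 0`), typed VERBATIM in that convention as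
`PolarizationSign.AxisReflectionCovariant` / `PolarizationSign.WardTransversal`, are therefore — for a kernel in the `hessKer`
convention — properties of `flipK T`, and `wardTransversal_flipK_iff` / `axisReflectionCovariant_flipK_iff` below spell out what they
say about `T` itself (the forward first-index divergence law; the reflection law with the unit shifts of the two indices
interchanged in sign).  The placement is not cosmetic: a kernel satisfying BOTH reflection laws has `2e_α`-periodic off-diagonal
channels `(α, ν)`, hence — if it decays — vanishing ones.  The consumers' conclusions (zeroth and first moments vanish, second
moments) are insensitive to the flip (`hasSum_flipK_iff`, `hasSum_firstMoment_of_flipK`, `secondMoment_flipK`). [folklore] -/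
def flipK (T : EKer D) : EKer D := fun μ ν z => T μ ν (-z)

/-- Entries of the flipped kernel. [folklore] -/
@[simp] theorem flipK_apply (T : EKer D) (μ ν : Fin D) (z : Fin D → ℤ) : flipK T μ ν z = T μ ν (-z) := rfl

/-- `flipK` is an involution. [folklore] -/
theorem flipK_flipK (T : EKer D) : flipK (flipK T) = T := by
  funext μ ν z; simp only [flipK_apply, neg_neg]

/-- `|−z|₁ = |z|₁`. [folklore] -/
theorem l1_neg_eq (z : Fin D → ℤ) : l1 (-z) = l1 z := by
  unfold B12Sec2to5.l1
  exact Finset.sum_congr rfl fun μ _ => by simp only [Pi.neg_apply, Int.cast_neg, abs_neg]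

/-- A (5.10)-type decay bound is insensitive to the flip. [folklore] -/
theorem decay510_flipK {T : EKer D} {C δ : ℝ} {μ ν : Fin D} (h : Decay510 (T μ ν) C δ) : Decay510 (flipK T μ ν) C δ := by
  intro z
  rw [flipK_apply, ← l1_neg_eq z]
  exact h (-z)
/-- `HasSum` of a channel is insensitive to the flip (re-indexing by `z ↦ −z`). [folklore] -/
theorem hasSum_flipK_iff {T : EKer D} {c e : Fin D} {a : ℝ} : HasSum (flipK T c e) a ↔ HasSum (T c e) a := by
  have h : flipK T c e = (T c e) ∘ (Equiv.neg (Fin D → ℤ)) := by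
    funext z; simp only [flipK_apply, Function.comp_apply, Equiv.neg_apply]
  rw [h, Equiv.hasSum_iff]

/-- Vanishing first moments are insensitive to the flip (the flip changes their sign). [folklore] -/
theorem hasSum_firstMoment_of_flipK {T : EKer D} {c e ρ : Fin D}
    (h : HasSum (fun t : Fin D → ℤ => t ρ • flipK T c e t) 0) : HasSum (fun t : Fin D → ℤ => t ρ • T c e t) 0 := by
  have h1 : HasSum ((fun t : Fin D → ℤ => t ρ • flipK T c e t) ∘ (Equiv.neg (Fin D → ℤ))) 0 := (Equiv.hasSum_iff _).2 h
  have h2 : ((fun t : Fin D → ℤ => t ρ • flipK T c e t) ∘ (Equiv.neg (Fin D → ℤ))) = fun t => -(t ρ • T c e t) := by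
    funext t
    simp only [Function.comp_apply, Equiv.neg_apply, flipK_apply, Pi.neg_apply, neg_neg, neg_smul]
  rw [h2] at h1
  simpa only [neg_neg, neg_zero] using h1.neg

/-- The (1.22) second moments are insensitive to the flip. [folklore] -/
theorem secondMoment_flipK (T : EKer D) (μ ν : Fin D) : secondMoment (flipK T) μ ν = secondMoment T μ ν := by
  unfold B12Beta.secondMoment
  rw [← (Equiv.neg (Fin D → ℤ)).tsum_eq (fun x => T μ ν x * (x μ : ℝ) * (x ν : ℝ))]
  refine tsum_congr fun x => ?_
  simp only [flipK_apply, Equiv.neg_apply, Pi.neg_apply, Int.cast_neg]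
  ring

/-- `ε(−w) = −εw` for the single-axis reflection. [folklore] -/
theorem axisReflect_neg (α : Fin D) (w : Fin D → ℤ) : axisReflect α (-w) = -axisReflect α w := by
  funext i
  simp only [axisReflect_apply, Pi.neg_apply]
  split_ifs <;> simp

/-- WHAT THE PRINTED WARD IDENTITY (5.9) SAYS ABOUT A KERNEL IN THE `hessKer` CONVENTION: `WardTransversal (flipK T)` is the FORWARD
first-index divergence law `Σ_μ (T_{μν}(z + e_μ) − T_{μν}(z)) = 0` (vs. the backward one `Σ_μ (T_{μν}(z − e_μ) − T_{μν}(z)) = 0` that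
`WardTransversal T` would state). [folklore] -/
theorem wardTransversal_flipK_iff (T : EKer D) :
    WardTransversal (flipK T) ↔ ∀ (ν : Fin D) (z : Fin D → ℤ), ∑ μ, (T μ ν (z + unitVec μ) - T μ ν z) = 0 := by
  have e1 : ∀ (w : Fin D → ℤ) (μ : Fin D), -(w - unitVec μ) = -w + unitVec μ := fun w μ => by abel
  unfold PolarizationSign.WardTransversal
  constructor
  · intro h ν z
    have h' := h ν (-z)
    simp only [flipK_apply, e1, neg_neg] at h'
    exact h'
  · intro h ν w
    simp only [flipK_apply, e1]
    exact h ν (-w)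

/-- WHAT THE PRINTED REFLECTION COVARIANCE (5.7)–(5.8) SAYS ABOUT A KERNEL IN THE `hessKer` CONVENTION: `AxisReflectionCovariant (flipK T)`
is the law `T_{μν}(εz + [μ=α]e_α − [ν=α]e_α) = ε_μ ε_ν T_{μν}(z)` — the unit shifts of the two indices enter with the signs OPPOSITE to
those of `AxisReflectionCovariant T`. [folklore] -/
theorem axisReflectionCovariant_flipK_iff (T : EKer D) :
    AxisReflectionCovariant (flipK T) ↔ ∀ (α μ ν : Fin D) (z : Fin D → ℤ),
      T μ ν (axisReflect α z + (if μ = α then unitVec α else 0) - (if ν = α then unitVec α else 0))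
        = reflSign α μ * reflSign α ν * T μ ν z := by
  have e2 : ∀ (α : Fin D) (w A B : Fin D → ℤ), -(axisReflect α w - A + B) = axisReflect α (-w) + A - B :=
    fun α w A B => by rw [axisReflect_neg]; abel
  unfold PolarizationSign.AxisReflectionCovariant
  constructor
  · intro h α μ ν z
    have h' := h α μ ν (-z)
    simp only [flipK_apply, e2, neg_neg] at h'
    exact h'
  · intro h α μ ν w
    simp only [flipK_apply, e2]
    exact h α μ ν (-w)

end Flip

section EndpointPrinted

open FlowStep FlowStepRuns DagBinding
open Literature.MathematicalPhysics.QuantumFieldTheory.Balaban1983to89.Beta.VectorTailsLoc (fam kfam)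
open Literature.MathematicalPhysics.QuantumFieldTheory.Balaban1983to89.Beta.RemainderChain (RemainderConst)
open Literature.MathematicalPhysics.QuantumFieldTheory.Balaban1983to89.Beta.VectorLegVolumeAdapter (MvE)
open Literature.MathematicalPhysics.QuantumFieldTheory.Balaban1983to89.Beta.PolarizationSign
  (WardTransversal AxisReflectionCovariant MomentSummable)
open Literature.MathematicalPhysics.QuantumFieldTheory.Balaban1983to89.Beta.ScalewiseVectorSeam
  (endpointExistence_of_scalewise_vectorSeam_readout122 hasSum_zero_of_ward hasSum_firstMoment_zero_of_reflection
    absMoment₂_and_momentSummable_of_decay)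

variable {L : Type*}

/-- **THE ENDPOINT THEOREM OVER JET DATA, CONVENTION-FREE FORM** (`ScalewiseVectorSeam.endpointExistence_of_scalewise_vectorSeam_readout122`
at `T := TbalOf Lc Js`, `𝒯 := TshotOf Lc Jc`, its `hTA` DISCHARGED by `hTA_TbalOf`): the symmetry input is asked directly as the socket's
`(T0)`/`(T1)` — every channel of every one-step kernel sums to zero and has vanishing first moments (statements insensitive to the choice
of difference variable, `hasSum_flipK_iff` / `hasSum_firstMoment_of_flipK`).  Remaining: `hT0`, `hT1`, `hβ`, `D1Tel`, `D1Rep` + the standing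
hypotheses.  Discharges nothing of `BetaPertH` by itself. [folklore] -/
theorem endpointExistence_of_D1_T0T1 (a : ℝ) (ha : 0 < a)
    (h12 : B5.Prop12Printed (fam (fun i : ℕ+ × ℕ => ((i.1 : ℕ+) : ℕ)) (fun i => i.1.pos) MvE a ha))
    (h126 : B5.Kernel126_127Printed (kfam (fun i : ℕ+ × ℕ => ((i.1 : ℕ+) : ℕ)) MvE))
    {SL : Finset L} (hSL : SL.Nonempty) (k : L → Fin 4) {μ ν : Fin 4}
    {β : HBeta} {Cn : B12.Construction} (hgen : ForwardGenerated Cn β)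
    (Sβ : B12Beta.OneLoopSplit β) (hμν : μ ≠ ν) {N : ℝ} (hN : N ≠ 0) {Lc : ℕ} [NeZero Lc] (hL : 2 ≤ Lc)
    (Js : ℕ → JetData 3 Lc) (Jc : ∀ m : ℕ, JetData 3 (Lc ^ m))
    (hT0 : ∀ j (c e : Fin 4), HasSum (TbalOf Lc Js j c e) 0)
    (hT1 : ∀ j (c e ρ : Fin 4), HasSum (fun t : Fin 4 → ℤ => t ρ • TbalOf Lc Js j c e t) 0)
    (hβ : ∀ j, Sβ.β0 j = secondMoment (TbalOf Lc Js j) μ ν) (htel : D1Tel Lc Js Jc)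
    {cc : ℝ} {M : ℕ → ℕ}
    (hc : 1 ≤ cc) (hM : ∀ L : ℕ, 2 ≤ L → 1 ≤ M L ∧ (L : ℝ) ≤ cc * M L) (hML : ∀ L : ℕ, 2 ≤ L → M L ≤ L)
    (hrep : D1Rep Lc Jc N μ ν a SL k)
    {rr γ₀ β' : ℝ} (hγ₀ : 0 < γ₀) (hrem : RemainderConst Sβ γ₀ rr) (hr : rr ≤ B12Normalization.stepBal N Lc)
    (hβ' : 0 ≤ β') (hcont : BetaContH γ₀ β) (hup : BetaUpperH β' γ₀ β) : EndpointExistence Cn := by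
  obtain ⟨U, hU⟩ := hrep
  exact endpointExistence_of_scalewise_vectorSeam_readout122 a ha h12 h126 hSL k hgen Sβ hμν hN hL (TbalOf Lc Js) (TshotOf Lc Jc)
    (hTA_TbalOf Js) hT0 hT1 hβ htel hc hM hML hU hγ₀ hrem hr hβ' hcont hup

/-- **THE ENDPOINT THEOREM OVER JET DATA, PRINTED-PROPERTIES FORM** — the analogue, for `T := TbalOf Lc Js`, `𝒯 := TshotOf Lc Jc`, of
`ScalewiseVectorSeam.endpointExistence_of_scalewise_vectorSeam_printed`, with the per-step decay binder `hdec` DISCHARGED for every jet datum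
(`hdec_TbalOf`) and the printed p. 293 properties asked of the one-step kernels READ IN THE PRINTED DIFFERENCE VARIABLE: the Ward identity
(5.9) `hW` and the reflection covariance (5.7)–(5.8) `hR` of `flipK (TbalOf Lc Js j)` (see `flipK`: `hessKer`'s variable is second-minus-first,
the printed one first-minus-second; `wardTransversal_flipK_iff` / `axisReflectionCovariant_flipK_iff` give the equivalent laws on `TbalOf`
itself).  Route: `hdec` ⇒ summable moments of the flipped kernel ⇒ (T0) by `ScalewiseVectorSeam.hasSum_zero_of_ward`, (T1) by
`ScalewiseVectorSeam.hasSum_firstMoment_zero_of_reflection`, transported back through the flip ⇒ `endpointExistence_of_D1_T0T1`.  What remains,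
exactly: `hW`, `hR` (structural, for Bałaban's jets: gauge and lattice symmetry of the typed step-`j` system), `hβ`, `D1Tel`, `D1Rep`, and the
cell's standing hypotheses.  Discharges nothing of `BetaPertH` by itself. [folklore] -/
theorem endpointExistence_of_D1_printed (a : ℝ) (ha : 0 < a)
    (h12 : B5.Prop12Printed (fam (fun i : ℕ+ × ℕ => ((i.1 : ℕ+) : ℕ)) (fun i => i.1.pos) MvE a ha))
    (h126 : B5.Kernel126_127Printed (kfam (fun i : ℕ+ × ℕ => ((i.1 : ℕ+) : ℕ)) MvE))
    {SL : Finset L} (hSL : SL.Nonempty) (k : L → Fin 4) {μ ν : Fin 4}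
    {β : HBeta} {Cn : B12.Construction} (hgen : ForwardGenerated Cn β)
    (Sβ : B12Beta.OneLoopSplit β) (hμν : μ ≠ ν) {N : ℝ} (hN : N ≠ 0) {Lc : ℕ} [NeZero Lc] (hL : 2 ≤ Lc)
    (Js : ℕ → JetData 3 Lc) (Jc : ∀ m : ℕ, JetData 3 (Lc ^ m))
    (hW : ∀ j, WardTransversal (flipK (TbalOf Lc Js j))) (hR : ∀ j, AxisReflectionCovariant (flipK (TbalOf Lc Js j)))
    (hβ : ∀ j, Sβ.β0 j = secondMoment (TbalOf Lc Js j) μ ν) (htel : D1Tel Lc Js Jc)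
    {cc : ℝ} {M : ℕ → ℕ}
    (hc : 1 ≤ cc) (hM : ∀ L : ℕ, 2 ≤ L → 1 ≤ M L ∧ (L : ℝ) ≤ cc * M L) (hML : ∀ L : ℕ, 2 ≤ L → M L ≤ L)
    (hrep : D1Rep Lc Jc N μ ν a SL k)
    {rr γ₀ β' : ℝ} (hγ₀ : 0 < γ₀) (hrem : RemainderConst Sβ γ₀ rr) (hr : rr ≤ B12Normalization.stepBal N Lc)
    (hβ' : 0 ≤ β') (hcont : BetaContH γ₀ β) (hup : BetaUpperH β' γ₀ β) : EndpointExistence Cn := by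
  have hS : ∀ j, MomentSummable (flipK (TbalOf Lc Js j)) 3 := fun j => by
    obtain ⟨C, δ, hδ, hd⟩ := hdec_TbalOf (Lc := Lc) Js j
    exact (absMoment₂_and_momentSummable_of_decay hδ (fun μ' ν' => decay510_flipK (hd μ' ν'))).2
  exact endpointExistence_of_D1_T0T1 a ha h12 h126 hSL k hgen Sβ hμν hN hL Js Jc
    (fun j c e => hasSum_flipK_iff.1 (hasSum_zero_of_ward (hS j) (hW j) c e))
    (fun j c e ρ => hasSum_firstMoment_of_flipK (hasSum_firstMoment_zero_of_reflection (hS j) (hR j) c e ρ))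
    hβ htel hc hM hML hrep hγ₀ hrem hr hβ' hcont hup

end EndpointPrinted

/-! ## §9 (v1.1; RULING (R23)) EXIT-B's statement side as a closed Prop over step jet data: `D1Drift`, and the END from it

The β sub-cell lead's minimal form of EXIT-B reads: the typed step kernels `TbalOf` (§6) + Bałaban's step jet data + `D1Drift`
STATED; EXIT-A = `D1Drift` PROVED.  `D1Drift Lc Js N μ ν` says that the off-diagonal second moments `β⁰_j := secondMoment
(TbalOf Lc Js j) μ ν` — the (1.22)-type one-loop coefficients of the typed step-`j` systems of the jet data `Js` — satisfy
`|Σ_{j<k} β⁰_j − k · stepBal N Lc| ≤ A` for some `A` and all `k` (`Beta.Drift.OneLoopDrift`).  It is a PREDICATE over the jet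
parameters; for Bałaban's stencils it is the located UNPRINTED one-loop content behind [Balaban1987RG1] Theorem 2 (p. 259) at
END grade, and NOTHING here asserts it.  The END from it needs only the identification `hβ`, the printed remainder constant (D4)
and continuity (C): an4's `DriftRemainder.endpointExistence_of_drift_remainderConst_cont`. [folklore] -/

section StepDrift

open FlowStep FlowStepRuns DagBinding
open Literature.MathematicalPhysics.QuantumFieldTheory.Balaban1983to89.Beta.VectorTailsLoc (fam kfam)
open Literature.MathematicalPhysics.QuantumFieldTheory.Balaban1983to89.Beta.RemainderChain (RemainderConst)
open Literature.MathematicalPhysics.QuantumFieldTheory.Balaban1983to89.Beta.VectorLegVolumeAdapter (MvE)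
open Literature.MathematicalPhysics.QuantumFieldTheory.Balaban1983to89.Beta.PolarizationSign (WardTransversal AxisReflectionCovariant)
open Literature.MathematicalPhysics.QuantumFieldTheory.Balaban1983to89.Beta.Drift (OneLoopDrift)
open Literature.MathematicalPhysics.QuantumFieldTheory.Balaban1983to89.Beta.DriftRemainder
  (endpointExistence_of_drift_remainderConst_cont)

variable {Lc : ℕ} [NeZero Lc]

/-- **EXIT-B, STATEMENT SIDE (RULING (R23)): THE DRIFT OF THE (1.22)-TYPE COEFFICIENTS OF THE TYPED STEP SYSTEMS.**  For step jet
data `Js`, colour parameter `N` and a channel `(μ, ν)`: the one-loop coefficients `β⁰_j := secondMoment (TbalOf Lc Js j) μ ν` drift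
with slope `B12Normalization.stepBal N Lc = (11N²/(12π²))·log Lc` up to a bounded cumulative defect —
`∃ A, ∀ k, |Σ_{j<k} β⁰_j − k · stepBal N Lc| ≤ A`.  A PREDICATE over the jet parameters (for Bałaban's stencils: the located unprinted
one-loop estimate behind B12 Theorem 2 at END grade), NEVER a fact; its proof for Bałaban's jets is EXIT-A of the cell. [folklore] -/
def D1Drift (Lc : ℕ) [NeZero Lc] (Js : ℕ → JetData 3 Lc) (N : ℝ) (μ ν : Fin 4) : Prop :=
  ∃ A : ℝ, OneLoopDrift (B12Normalization.stepBal N Lc) A (fun j => secondMoment (TbalOf Lc Js j) μ ν)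

/-- **THE END FROM `D1Drift` + (D4) + (C)** (four binders beyond the standing ones; no legs, tables, `K^∞`, composite kernels or
symmetry binders): an4's `DriftRemainder.endpointExistence_of_drift_remainderConst_cont` at `β⁰ := secondMoment ∘ TbalOf Lc Js`.
Discharges nothing of `BetaPertH` by itself (`D1Drift` is a hypothesis). [folklore] -/
theorem endpointExistence_of_D1Drift {β : HBeta} {Cn : B12.Construction} (hgen : ForwardGenerated Cn β)
    (Sβ : B12Beta.OneLoopSplit β) (Js : ℕ → JetData 3 Lc) {N : ℝ} {μ ν : Fin 4}
    (hβ : ∀ j, Sβ.β0 j = secondMoment (TbalOf Lc Js j) μ ν) (hD : D1Drift Lc Js N μ ν)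
    {rr γ₀ : ℝ} (hγ₀ : 0 < γ₀) (hrem : RemainderConst Sβ γ₀ rr) (hr : rr ≤ B12Normalization.stepBal N Lc)
    (hcont : BetaContH γ₀ β) : EndpointExistence Cn := by
  obtain ⟨A, hA⟩ := hD
  have hβfun : Sβ.β0 = fun j => secondMoment (TbalOf Lc Js j) μ ν := funext hβ
  have hA' : OneLoopDrift (B12Normalization.stepBal N Lc) A Sβ.β0 := by rw [hβfun]; exact hA
  exact endpointExistence_of_drift_remainderConst_cont hgen Sβ hγ₀ hA' hrem hr hcont

end StepDrift

/-! ## §10 (v1.2) PROOF ROUTE ⟹ STATEMENT: `D1Drift` from the scale-wise data, and the END with (D5) = (C) only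

Gated on the lead's `Beta/ScalewiseVectorSeam` v1.6 (p187481, `oneLoopDrift_of_scalewise_printed_flip`, `splitOf`,
`endpointExistence_of_scalewise_vectorSeam_printed_flip_cont`), now in the tree.  APPEND-ONLY over v1.1. -/

section StepDriftRoute

open FlowStep FlowStepRuns DagBinding
open Literature.MathematicalPhysics.QuantumFieldTheory.Balaban1983to89.Beta.VectorTailsLoc (fam kfam)
open Literature.MathematicalPhysics.QuantumFieldTheory.Balaban1983to89.Beta.RemainderChain (RemainderConst)
open Literature.MathematicalPhysics.QuantumFieldTheory.Balaban1983to89.Beta.VectorLegVolumeAdapter (MvE)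
open Literature.MathematicalPhysics.QuantumFieldTheory.Balaban1983to89.Beta.PolarizationSign (WardTransversal AxisReflectionCovariant)
open Literature.MathematicalPhysics.QuantumFieldTheory.Balaban1983to89.Beta.Drift (OneLoopDrift)
open Literature.MathematicalPhysics.QuantumFieldTheory.Balaban1983to89.Beta.DriftRemainder

variable {Lc : ℕ} [NeZero Lc] {L : Type*}

/-- **PROOF ROUTE ⟹ STATEMENT**: the scale-wise data in the flipped-printed form of §8 (`hdec` discharged by `hdec_TbalOf`; the printed
Ward identity `hW` and reflection covariance `hR` asked of `flipK (TbalOf Lc Js j)`, RULING (R21)), `D1Tel` and `D1Rep` give `D1Drift`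
— the lead's `ScalewiseVectorSeam.oneLoopDrift_of_scalewise_printed_flip` (v1.6 §8) at `T := TbalOf Lc Js`, `𝒯 := TshotOf Lc Jc` and the
split `ScalewiseVectorSeam.splitOf (j ↦ secondMoment (TbalOf Lc Js j) μ ν)` (v1.6 §9).  The binders `hW`, `hR`, `htel`, `hrep` are
hypotheses about the jet data, never facts; for Bałaban's jets `hrep` (equivalently, given the rest, the conclusion) is EXIT-A, the wall.
Discharges nothing of `BetaPertH` by itself. [folklore] -/
theorem d1Drift_of_D1Tel_D1Rep (a : ℝ) (ha : 0 < a)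
    (h12 : B5.Prop12Printed (fam (fun i : ℕ+ × ℕ => ((i.1 : ℕ+) : ℕ)) (fun i => i.1.pos) MvE a ha))
    (h126 : B5.Kernel126_127Printed (kfam (fun i : ℕ+ × ℕ => ((i.1 : ℕ+) : ℕ)) MvE))
    {SL : Finset L} (hSL : SL.Nonempty) (k : L → Fin 4) {μ ν : Fin 4} (hμν : μ ≠ ν) {N : ℝ} (hN : N ≠ 0) (hL : 2 ≤ Lc)
    (Js : ℕ → JetData 3 Lc) (Jc : ∀ m : ℕ, JetData 3 (Lc ^ m))
    (hW : ∀ j, WardTransversal (flipK (TbalOf Lc Js j))) (hR : ∀ j, AxisReflectionCovariant (flipK (TbalOf Lc Js j)))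
    (htel : D1Tel Lc Js Jc)
    {cc : ℝ} {M : ℕ → ℕ} (hc : 1 ≤ cc) (hM : ∀ L : ℕ, 2 ≤ L → 1 ≤ M L ∧ (L : ℝ) ≤ cc * M L) (hML : ∀ L : ℕ, 2 ≤ L → M L ≤ L)
    (hrep : D1Rep Lc Jc N μ ν a SL k) : D1Drift Lc Js N μ ν := by
  obtain ⟨U, hU⟩ := hrep
  exact ScalewiseVectorSeam.oneLoopDrift_of_scalewise_printed_flip a ha h12 h126 hSL k
    (ScalewiseVectorSeam.splitOf fun j => secondMoment (TbalOf Lc Js j) μ ν) hμν hN hL (TbalOf Lc Js) (TshotOf Lc Jc)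
    (hdec_TbalOf Js) hW hR (fun _ => rfl) htel hc hM hML hU

/-- **THE END WITH (D5) = (C) ONLY, PRINTED-PROPERTIES FORM** (RULING (R22): no `hβ′ : 0 ≤ β′`, no `hup : BetaUpperH β′ γ₀ β` — the upper
bound is derived from the drift downstream, an4's `DriftRemainder.endpointExistence_of_drift_remainderConst_cont`): §8's
`endpointExistence_of_D1_printed` with those two binders DROPPED, assembled as `d1Drift_of_D1Tel_D1Rep` ⟹ `endpointExistence_of_D1Drift`
(§9).  What remains, exactly: `hW`, `hR`, `hβ`, `D1Tel`, `D1Rep`, the printed remainder constant (D4) with `rr ≤ stepBal N Lc`, continuity (C),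
and the cell's standing hypotheses.  Discharges nothing of `BetaPertH` by itself. [folklore] -/
theorem endpointExistence_of_D1_printed_cont (a : ℝ) (ha : 0 < a)
    (h12 : B5.Prop12Printed (fam (fun i : ℕ+ × ℕ => ((i.1 : ℕ+) : ℕ)) (fun i => i.1.pos) MvE a ha))
    (h126 : B5.Kernel126_127Printed (kfam (fun i : ℕ+ × ℕ => ((i.1 : ℕ+) : ℕ)) MvE))
    {SL : Finset L} (hSL : SL.Nonempty) (k : L → Fin 4) {μ ν : Fin 4}
    {β : HBeta} {Cn : B12.Construction} (hgen : ForwardGenerated Cn β)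
    (Sβ : B12Beta.OneLoopSplit β) (hμν : μ ≠ ν) {N : ℝ} (hN : N ≠ 0) (hL : 2 ≤ Lc)
    (Js : ℕ → JetData 3 Lc) (Jc : ∀ m : ℕ, JetData 3 (Lc ^ m))
    (hW : ∀ j, WardTransversal (flipK (TbalOf Lc Js j))) (hR : ∀ j, AxisReflectionCovariant (flipK (TbalOf Lc Js j)))
    (hβ : ∀ j, Sβ.β0 j = secondMoment (TbalOf Lc Js j) μ ν) (htel : D1Tel Lc Js Jc)
    {cc : ℝ} {M : ℕ → ℕ}
    (hc : 1 ≤ cc) (hM : ∀ L : ℕ, 2 ≤ L → 1 ≤ M L ∧ (L : ℝ) ≤ cc * M L) (hML : ∀ L : ℕ, 2 ≤ L → M L ≤ L)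
    (hrep : D1Rep Lc Jc N μ ν a SL k)
    {rr γ₀ : ℝ} (hγ₀ : 0 < γ₀) (hrem : RemainderConst Sβ γ₀ rr) (hr : rr ≤ B12Normalization.stepBal N Lc)
    (hcont : BetaContH γ₀ β) : EndpointExistence Cn :=
  endpointExistence_of_D1Drift hgen Sβ Js hβ (d1Drift_of_D1Tel_D1Rep a ha h12 h126 hSL k hμν hN hL Js Jc hW hR htel hc hM hML hrep)
    hγ₀ hrem hr hcont

end StepDriftRoute

end Literature.MathematicalPhysics.QuantumFieldTheory.Balaban1983to89.Beta.OneStepKernelFamily
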